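import Mathlib
import Literature.NumberTheory.LFunctions.Zhang2022.Section12Eval1217TopRanges
import Literature.NumberTheory.LFunctions.Zhang2022.Section12Xi15Hbar16Rel
import Literature.NumberTheory.LFunctions.Zhang2022.TypedSection12CExact
import HarnessLib

/-!
# Zhang (2022) §12: (12.17) from the EXACT-reading nodes — `Top1225Ex`, `Top1522Ex`, `Win1217Ex` ⇒
# `Eval1217` / `Eval1217Rel` (the assembler of record of the re-type RT-02, both currencies)

Topic `Literature/NumberTheory/LFunctions/Zhang2022` (Landau–Siegel audit tree; verdict-neutral).
Y. Zhang, *Discrete mean estimates and the Landau–Siegel zero*, arXiv:2211.02515v1 (2022)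
[Zhang2022LandauSiegel]. **Status of the source: an unrefereed manuscript under adjudication** (campaign D-0069;
ZHANG-L discharge lane, WP12; re-type of record RT-02 = R-18, relative currency R-25). Everything in this file is
PROVED (theorems only; no new definitions, no new named facts; standard axioms); nothing here is a claim about
Theorems 1–2 of the source or about Landau–Siegel zeros.

"Finally, by (12.9), (12.15) and (12.16) we conclude `Ξ₁₅ = (e₁* + 2e₂* + ε)𝔞𝔓` (12.17)" (p. 73, tex L3713).
The typed nodes of `TypedSection12CExact` are the two top-range evaluations of `S_j(𝐚₁₂,𝐚₂₅)`,
`S_j(𝐚₁₅,𝐚₂₂)` with the manuscript's own windows `𝓦_j`, `𝓦*_j` kept exact (`Top1225Ex`, `Top1522Ex`) and the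
window value `Win1217Ex` (`‖Σ_j(w_j/α)main1213intEx_j + conj Σ_j(w_j/α)main12u049intEx_j − 2𝔞e₂*‖ ≤ 5·10⁻⁶𝔞`).
Here they are plugged into the generic assembler `Sec12D.eval1217_of_top_ranges` /
`eval1217Rel_of_top_ranges` (`Section12Eval1217TopRanges`). The one analytic input this needs beyond the nodes
is that the exact main terms are `O(α𝔞)` UNIFORMLY in `D` (for the tacit `E(·,·) = o(𝔓)` of "by Proposition
7.1"); it is proved here from the definitions:

| decl | content |
|---|---|
| `norm_frakwStarEx_rpow_le` | `‖𝓦*ˣ_j(P^z)‖ ≤ 1 + (9/2 + 15|c′|π)·521π` on `[0.496, 0.5]` (`|(P^z/P″₁)^{−β₆}| = 1`, `β₆ ∈ iℝ`) |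
| `norm_cpowInt_le`, `norm_cpowLogInt_le` | `‖∫₁^X t^{β₆−1}dt‖ ≤ log X`, `‖∫₁^X t^{β₆−1}log t dt‖ ≤ (log X)²` (`X ≥ 1`) |
| `norm_frakwEx_rpow_le` | `‖𝓦ˣ_j(P^z)‖ ≤ W(c′) := 1 + 18(1+5|c′|π)²(521π)² + (3/2 + 6(1+5|c′|π))·521π` on `[0.496, 0.5]` |
| `norm_main1213intEx_le`, `norm_main12u049intEx_le` | the exact main terms are `≤ K(c′)·α·𝔞`, `j = 1,2,3`, `log D ≥ 1` |
| **`eval1217_of_exact`**, `dedEval1217Ex_holds` | `Prop71 → Eq129 → Eq1212 → Mid1225 → Top1225Ex → Low1522 → Top1522Ex → Win1217Ex → Skeleton.Eval1217` — the typed `DedEval1217Ex c′` HOLDS (R-18) |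
| `eval1217_of_exact_leaves` | the same from `hXi : Xi15Hbar16 c′` and Lemma 8.1 (`Sec12D.ded129_holds`) — the zl-skel plug |
| **`eval1217Rel_of_exact`** | `Prop22i → Lemma23 → Prop71 → Lemma81 → Eval97With c′ k → Eq126 → Eq128 → Eq1212 → Mid1225 → Top1225Ex → Low1522 → Top1522Ex → Win1217Ex → Skeleton.Eval1217Rel` (R-25 currency of record; front end `Sec12D.xi15Hbar16_rel_of_eq126_eq128`, `eq129_rel_of_xi15_rel`) |
| `eval1217Rel_of_exact_xi` | the relative chain from `hXi` as typed |

Budget: `Win1217Ex`'s `5·10⁻⁶𝔞` sits inside the `10⁻⁵𝔞𝔓` of `Skeleton.Eval1217` with every other error `o(𝔓)`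
(resp. `o((𝔞+1)𝔓)`). No §12 CLAIM node is asserted: all eight range/window nodes remain hypotheses.

## References

* Y. Zhang, arXiv:2211.02515v1 (2022), §12 pp. 70–73, Lemma 12.3 proof (tex L3551–L3590), (12.13)–(12.17)
  (tex L3614–L3720); (2.10), (2.13), (2.22), (2.31); §7 Prop. 7.1. [cite: Zhang2022LandauSiegel, §12 (12.17) p.73]
-/

noncomputable section

open Complex Real ComplexConjugate
open Literature.NumberTheory.LFunctions.Zhang2022
open Literature.NumberTheory.LFunctions.Zhang2022.Skeleton
open Literature.NumberTheory.LFunctions.Zhang2022.Typed.Sec12A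
open Literature.NumberTheory.LFunctions.Zhang2022.Typed.Sec12C

namespace Literature.NumberTheory.LFunctions.Zhang2022.Sec12D

/-! ## Sizes of the exact windows on `[0.496, 0.5]` -/

section Windows

variable (c' : ℝ) {D : ℕ}

/-- `Re β₆ = 0`, `Re(−β₆) = 0`, `Re(β₆ − 1) = −1` (`β₆ = (3α/2)·i`, (2.22); cf. `Typed.Sec12A.beta6_eq_mul_I`).
[cite: Zhang2022LandauSiegel, §2 (2.22) p.9] -/
theorem beta6_re (D : ℕ) : (beta6 D).re = 0 ∧ (-beta6 D).re = 0 ∧ (beta6 D - 1).re = -1 := by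
  have e : beta6 D = ((3 * alpha D / 2 : ℝ) : ℂ) * I := by rw [beta6]; push_cast; ring
  have h : (beta6 D).re = 0 := by rw [e]; simp
  refine ⟨h, by simp [h], by simp [h]⟩

/-- `|x^{±β₆}| = 1` for real `x > 0` (`β₆` purely imaginary). [cite: Zhang2022LandauSiegel, §12 Lemma 12.1 proof p.68] -/
theorem norm_cpow_beta6 {x : ℝ} (hx : 0 < x) (D : ℕ) :
    ‖(x : ℂ) ^ beta6 D‖ = 1 ∧ ‖(x : ℂ) ^ (-beta6 D)‖ = 1 := by
  obtain ⟨h1, h2, -⟩ := beta6_re D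
  rw [Complex.norm_cpow_eq_rpow_re_of_pos hx, Complex.norm_cpow_eq_rpow_re_of_pos hx, h1, h2,
    Real.rpow_zero]
  exact ⟨rfl, rfl⟩

/-- **`‖𝓦*ˣ_j(P^z)‖ ≤ 1 + (9/2 + 15|c′|π)·521π`** on `z ∈ [0.496, 0.5]`, uniformly in `D` (`log D ≥ 1`):
`|(P^z/P″₁)^{−β₆}| = 1`, `‖β₆ − β_j‖ ≤ α(3/2 + 3(1+5|c′|π))`, `|log(P^z/P″₁)| ≤ 0.004 log P + 520𝓛`, `α log P = π`,
`α𝓛 ≤ π`. [cite: Zhang2022LandauSiegel, §12 (12.16) p.73] -/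
theorem norm_frakwStarEx_rpow_le (hD : 1 ≤ Real.log D) (j : ℕ) {z : ℝ} (hz1 : 0.496 ≤ z) (hz2 : z ≤ 0.5) :
    ‖frakwStarEx c' D j (bigP D ^ z)‖ ≤ 1 + (9 / 2 + 15 * |c'| * π) * (521 * π) := by
  have hπ := Real.pi_pos
  have hα := alpha_pos_of_log hD
  have hαP := alpha_mul_logP (D := D) hD
  have hαℓ := alpha_mul_ell_le (D := D) hD
  have hlogP : 0 ≤ Real.log (bigP D) := by
    rw [Skeleton.log_bigP]; exact pow_nonneg (by rw [ell]; linarith) _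
  have hℓ0 : 0 ≤ ell D := by rw [ell]; linarith
  have hβ6 := (norm_beta67 (D := D) hD).1
  have hβj := norm_betaJ_le c' hD j
  have hx : 0 < bigP D ^ z / P1pp D := div_pos (Real.rpow_pos_of_pos (bigP_pos D) z) (P1pp_pos hD)
  have hcpow := (norm_cpow_beta6 hx D).2
  have hcoef : ‖beta6 D - betaJ c' D j‖ ≤ alpha D * (9 / 2 + 15 * |c'| * π) := by
    calc ‖beta6 D - betaJ c' D j‖ ≤ ‖beta6 D‖ + ‖betaJ c' D j‖ := norm_sub_le _ _
      _ ≤ 3 * alpha D / 2 + 3 * alpha D * (1 + 5 * |c'| * π) := by rw [hβ6]; linarith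
      _ = alpha D * (9 / 2 + 15 * |c'| * π) := by ring
  have hlog := abs_log_rpow_div_P1pp_le (D := D) hD hz1 hz2
  rw [frakwStarEx, norm_mul, hcpow, one_mul]
  calc ‖-1 + (beta6 D - betaJ c' D j) * (Real.log (bigP D ^ z / P1pp D) : ℂ)‖
      ≤ ‖(-1 : ℂ)‖ + ‖(beta6 D - betaJ c' D j) * (Real.log (bigP D ^ z / P1pp D) : ℂ)‖ :=
        norm_add_le _ _
    _ = 1 + ‖beta6 D - betaJ c' D j‖ * |Real.log (bigP D ^ z / P1pp D)| := by
        rw [norm_neg, norm_one, norm_mul, Complex.norm_real, Real.norm_eq_abs]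
    _ ≤ 1 + alpha D * (9 / 2 + 15 * |c'| * π) * (0.004 * Real.log (bigP D) + 520 * ell D) := by
        gcongr
    _ = 1 + (9 / 2 + 15 * |c'| * π) * (0.004 * (alpha D * Real.log (bigP D)) +
          520 * (alpha D * ell D)) := by ring
    _ ≤ 1 + (9 / 2 + 15 * |c'| * π) * (0.004 * π + 520 * π) := by rw [hαP]; gcongr
    _ = 1 + (9 / 2 + 15 * |c'| * π) * (520.004 * π) := by ring
    _ ≤ 1 + (9 / 2 + 15 * |c'| * π) * (521 * π) := by gcongr; norm_num

/-- `‖∫₁^X t^{β₆−1} dt‖ ≤ log X` for `X ≥ 1` (`|t^{β₆−1}| = t⁻¹`). [cite: Zhang2022LandauSiegel, §12 Lemma 12.3 proof p.70] -/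
theorem norm_cpowInt_le (D : ℕ) {X : ℝ} (hX : 1 ≤ X) :
    ‖∫ t in (1 : ℝ)..X, (t : ℂ) ^ (beta6 D - 1)‖ ≤ Real.log X := by
  have hre := (beta6_re D).2.2
  have h0 : (0 : ℝ) ∉ Set.uIcc (1 : ℝ) X := by
    rw [Set.uIcc_of_le hX]; intro h; exact absurd h.1 (by norm_num)
  have hint : IntervalIntegrable (fun t : ℝ => t⁻¹) MeasureTheory.volume 1 X := by
    refine ContinuousOn.intervalIntegrable ?_
    refine continuousOn_inv₀.mono ?_
    intro t ht
    rw [Set.uIcc_of_le hX] at ht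
    exact ne_of_gt (by linarith [ht.1] : (0 : ℝ) < t)
  have h := intervalIntegral.norm_integral_le_of_norm_le hX
    (f := fun t : ℝ => (t : ℂ) ^ (beta6 D - 1)) (g := fun t : ℝ => t⁻¹)
    (Filter.Eventually.of_forall fun t ht => by
      have ht0 : 0 < t := by linarith [ht.1]
      rw [Complex.norm_cpow_eq_rpow_re_of_pos ht0, hre, Real.rpow_neg_one]) hint
  rwa [integral_inv h0, div_one] at h

/-- `‖∫₁^X t^{β₆−1}log t dt‖ ≤ (log X)²` for `X ≥ 1` (`|t^{β₆−1}log t| ≤ (log X)/t`).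
[cite: Zhang2022LandauSiegel, §12 Lemma 12.3 proof p.70] -/
theorem norm_cpowLogInt_le (D : ℕ) {X : ℝ} (hX : 1 ≤ X) :
    ‖∫ t in (1 : ℝ)..X, (t : ℂ) ^ (beta6 D - 1) * (Real.log t : ℂ)‖ ≤ Real.log X * Real.log X := by
  have hre := (beta6_re D).2.2
  have h0 : (0 : ℝ) ∉ Set.uIcc (1 : ℝ) X := by
    rw [Set.uIcc_of_le hX]; intro h; exact absurd h.1 (by norm_num)
  have hint : IntervalIntegrable (fun t : ℝ => t⁻¹) MeasureTheory.volume 1 X := by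
    refine ContinuousOn.intervalIntegrable ?_
    refine continuousOn_inv₀.mono ?_
    intro t ht
    rw [Set.uIcc_of_le hX] at ht
    exact ne_of_gt (by linarith [ht.1] : (0 : ℝ) < t)
  have h := intervalIntegral.norm_integral_le_of_norm_le hX
    (f := fun t : ℝ => (t : ℂ) ^ (beta6 D - 1) * (Real.log t : ℂ)) (g := fun t : ℝ => Real.log X * t⁻¹)
    (Filter.Eventually.of_forall fun t ht => by
      have ht0 : 0 < t := by linarith [ht.1]
      have hl0 : 0 ≤ Real.log t := Real.log_nonneg ht.1.le
      have hlX : Real.log t ≤ Real.log X := Real.log_le_log ht0 ht.2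
      rw [norm_mul, Complex.norm_cpow_eq_rpow_re_of_pos ht0, hre, Real.rpow_neg_one,
        Complex.norm_real, Real.norm_of_nonneg hl0, mul_comm]
      exact mul_le_mul_of_nonneg_right hlX (inv_nonneg.mpr ht0.le)) (hint.const_mul _)
  rwa [intervalIntegral.integral_const_mul, integral_inv h0, div_one] at h

/-- **`‖𝓦ˣ_j(P^z)‖ ≤ W(c′)`** on `z ∈ [0.496, 0.5]`, uniformly in `D` (`log D ≥ 1`), with
`W(c′) = 1 + 18(1+5|c′|π)²(521π)² + (3/2 + 6(1+5|c′|π))·521π`: `|(P^z/P″₁)^{β₆}| = 1`, `‖β_k‖ ≤ 3α(1+5|c′|π)`,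
`‖β₆‖ = 3α/2`, `u = log(P^z/P″₁)` and `log(P″₂/P^z) = 0.004 log P − u` both at most `0.008 log P + 520𝓛` in size,
the two `t`-integrals bounded by `log(P″₂/P^z)` and its square, `α log P = π`, `α𝓛 ≤ π`.
[cite: Zhang2022LandauSiegel, §12 Lemma 12.3 proof p.70, (12.13) p.71] -/
theorem norm_frakwEx_rpow_le (hD : 1 ≤ Real.log D) (j : ℕ) {z : ℝ} (hz1 : 0.496 ≤ z) (hz2 : z ≤ 0.5) :
    ‖frakwEx c' D j (bigP D ^ z)‖ ≤
      1 + 18 * (1 + 5 * |c'| * π) ^ 2 * (521 * π) ^ 2 + (3 / 2 + 6 * (1 + 5 * |c'| * π)) * (521 * π) := by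
  have hπ := Real.pi_pos
  have hα := alpha_pos_of_log hD
  have hαP := alpha_mul_logP (D := D) hD
  have hαℓ := alpha_mul_ell_le (D := D) hD
  have hℓ1 : 1 ≤ ell D := by rw [ell]; exact hD
  have hlogP : 0 ≤ Real.log (bigP D) := by rw [Skeleton.log_bigP]; positivity
  have hP := bigP_pos D
  have hPz : 0 < bigP D ^ z := Real.rpow_pos_of_pos hP z
  have hP1 := P1pp_pos (D := D) hD
  -- the base `x = P^z/P″₁`, `u = log x`, and the upper limit `X = P″₂/P^z`
  set x : ℝ := bigP D ^ z / P1pp D with hxdef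
  have hx : 0 < x := div_pos hPz hP1
  obtain ⟨hcpow, -⟩ := norm_cpow_beta6 hx D
  set u : ℝ := Real.log x with hudef
  have hU : |u| ≤ 0.004 * Real.log (bigP D) + 520 * ell D := abs_log_rpow_div_P1pp_le (D := D) hD hz1 hz2
  have hu_le : u ≤ 0.004 * Real.log (bigP D) := by
    have hlogℓ : 0 ≤ Real.log (ell D) := Real.log_nonneg hℓ1
    rw [hudef, hxdef, log_rpow_div_P1pp hD z]
    nlinarith
  set X : ℝ := P2pp D / bigP D ^ z with hXdef
  have hXpos : 0 < X := div_pos (P2pp_pos hD) hPz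
  have hXeq : X = bigP D ^ (0.004 : ℝ) / x := by
    have h1 := P2pp_div_P1pp (D := D) hD
    rw [hXdef, hxdef, ← h1]
    field_simp
  have hlogX : Real.log X = 0.004 * Real.log (bigP D) - u := by
    rw [hXeq, Real.log_div (Real.rpow_pos_of_pos hP _).ne' hx.ne', Real.log_rpow hP]
  set L : ℝ := Real.log X with hLdef
  have hL0 : 0 ≤ L := by linarith [hlogX, hu_le]
  have hX1 : 1 ≤ X := (Real.log_nonneg_iff hXpos).mp hL0
  set U₂ : ℝ := 0.008 * Real.log (bigP D) + 520 * ell D with hU₂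
  have huU : |u| ≤ U₂ := hU.trans (by rw [hU₂]; nlinarith)
  have hLU : L ≤ U₂ := by
    have := neg_abs_le u
    linarith [hlogX, hU, hU₂]
  have hU0 : 0 ≤ U₂ := (abs_nonneg u).trans huU
  -- `αU₂ ≤ 521π`
  have hV : alpha D * U₂ ≤ 521 * π := by
    have e : alpha D * U₂ = 0.008 * (alpha D * Real.log (bigP D)) + 520 * (alpha D * ell D) := by
      rw [hU₂]; ring
    rw [e, hαP]; nlinarith
  have hV0 : 0 ≤ alpha D * U₂ := mul_nonneg hα.le hU0
  -- the `β`'s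
  set c5 : ℝ := 1 + 5 * |c'| * π with hc5
  have hc50 : 0 ≤ c5 := by positivity
  have hβ6 := (norm_beta67 (D := D) hD).1
  have hb1 := norm_betaJ_le c' hD (j + 1)
  have hb2 := norm_betaJ_le c' hD (j + 2)
  -- the two `t`-integrals
  have hJ0 := norm_cpowInt_le D hX1
  have hJ1 := norm_cpowLogInt_le D hX1
  set J0 := ∫ t in (1 : ℝ)..X, (t : ℂ) ^ (beta6 D - 1) with hJ0def
  set J1 := ∫ t in (1 : ℝ)..X, (t : ℂ) ^ (beta6 D - 1) * (Real.log t : ℂ) with hJ1def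
  set b1 := betaJ c' D (j + 1) with hb1def
  set b2 := betaJ c' D (j + 2) with hb2def
  set Pw := ((x : ℝ) : ℂ) ^ beta6 D with hPw
  -- the two pieces of `𝓦ˣ`
  have hT1 : ‖Pw * (1 - b1 * b2 * J1)‖ ≤ 1 + ‖b1‖ * ‖b2‖ * (L * L) := by
    rw [norm_mul, hcpow, one_mul]
    calc ‖1 - b1 * b2 * J1‖ ≤ ‖(1 : ℂ)‖ + ‖b1 * b2 * J1‖ := norm_sub_le _ _
      _ = 1 + ‖b1‖ * ‖b2‖ * ‖J1‖ := by rw [norm_one, norm_mul, norm_mul]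
      _ ≤ 1 + ‖b1‖ * ‖b2‖ * (L * L) := by gcongr
  have hT2 : ‖Pw * (Real.log x : ℂ) * (-beta6 D + b1 + b2 + b1 * b2 * J0)‖ ≤
      |u| * (3 * alpha D / 2 + ‖b1‖ + ‖b2‖ + ‖b1‖ * ‖b2‖ * L) := by
    rw [norm_mul, norm_mul, hcpow, one_mul, Complex.norm_real, Real.norm_eq_abs]
    refine mul_le_mul_of_nonneg_left ?_ (abs_nonneg _)
    calc ‖-beta6 D + b1 + b2 + b1 * b2 * J0‖
        ≤ ‖-beta6 D‖ + ‖b1‖ + ‖b2‖ + ‖b1 * b2 * J0‖ := by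
          refine (norm_add_le _ _).trans ?_
          have := norm_add₃_le (a := -beta6 D) (b := b1) (c := b2)
          linarith
      _ = 3 * alpha D / 2 + ‖b1‖ + ‖b2‖ + ‖b1‖ * ‖b2‖ * ‖J0‖ := by
          rw [norm_neg, hβ6, norm_mul, norm_mul]
      _ ≤ 3 * alpha D / 2 + ‖b1‖ + ‖b2‖ + ‖b1‖ * ‖b2‖ * L := by gcongr
  have hF : ‖frakwEx c' D j (bigP D ^ z)‖ ≤
      (1 + ‖b1‖ * ‖b2‖ * (L * L)) + |u| * (3 * alpha D / 2 + ‖b1‖ + ‖b2‖ + ‖b1‖ * ‖b2‖ * L) := by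
    rw [frakwEx, norm_neg]
    exact (norm_sub_le _ _).trans (add_le_add hT1 hT2)
  -- numerical consolidation: `‖b_k‖ ≤ 3αc₅`, `L, |u| ≤ U₂`, `αU₂ ≤ 521π`
  have hbb : ‖b1‖ * ‖b2‖ ≤ (3 * alpha D * c5) * (3 * alpha D * c5) :=
    mul_le_mul hb1 hb2 (norm_nonneg _) (by positivity)
  have h1 : ‖b1‖ * ‖b2‖ * (L * L) ≤ 9 * c5 ^ 2 * (521 * π) ^ 2 := by
    calc ‖b1‖ * ‖b2‖ * (L * L) ≤ (3 * alpha D * c5) * (3 * alpha D * c5) * (U₂ * U₂) := by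
          gcongr
      _ = 9 * c5 ^ 2 * (alpha D * U₂) ^ 2 := by ring
      _ ≤ 9 * c5 ^ 2 * (521 * π) ^ 2 := by gcongr
  have h2 : |u| * (3 * alpha D / 2) ≤ 3 / 2 * (521 * π) := by
    calc |u| * (3 * alpha D / 2) ≤ U₂ * (3 * alpha D / 2) := by gcongr
      _ = 3 / 2 * (alpha D * U₂) := by ring
      _ ≤ 3 / 2 * (521 * π) := by gcongr
  have h3 : |u| * (‖b1‖ + ‖b2‖) ≤ 6 * c5 * (521 * π) := by
    calc |u| * (‖b1‖ + ‖b2‖) ≤ U₂ * (3 * alpha D * c5 + 3 * alpha D * c5) := by gcongr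
      _ = 6 * c5 * (alpha D * U₂) := by ring
      _ ≤ 6 * c5 * (521 * π) := by gcongr
  have h4 : |u| * (‖b1‖ * ‖b2‖ * L) ≤ 9 * c5 ^ 2 * (521 * π) ^ 2 := by
    calc |u| * (‖b1‖ * ‖b2‖ * L) ≤ U₂ * ((3 * alpha D * c5) * (3 * alpha D * c5) * U₂) := by gcongr
      _ = 9 * c5 ^ 2 * (alpha D * U₂) ^ 2 := by ring
      _ ≤ 9 * c5 ^ 2 * (521 * π) ^ 2 := by gcongr
  have e : |u| * (3 * alpha D / 2 + ‖b1‖ + ‖b2‖ + ‖b1‖ * ‖b2‖ * L) =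
      |u| * (3 * alpha D / 2) + |u| * (‖b1‖ + ‖b2‖) + |u| * (‖b1‖ * ‖b2‖ * L) := by ring
  rw [e] at hF
  rw [hc5] at h1 h3 h4
  linarith

end Windows

/-! ## The exact main terms are `O(α𝔞)` uniformly in `D` -/

section MainTerms

variable (c' : ℝ) {D : ℕ} [NeZero D] (χ : DirichletCharacter ℂ D)

/-- `‖𝔣𝔣_{a,k}(w)‖ ≤ 1 + |a|π|w|` (`𝔣𝔣_{a,k}(w) = (1 + aπiw)e^{kπiw}`, (8.13)–(8.18)).
[cite: Zhang2022LandauSiegel, §8 (8.13)–(8.18) p.48] -/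
private theorem norm_ffF_le' (a k : ℚ) (w : ℝ) : ‖ffF a k w‖ ≤ 1 + |(a : ℝ)| * π * |w| := by
  have e : cexp (k * π * I * w) = cexp (((k * π * w : ℝ)) * I) := by push_cast; ring_nf
  rw [ffF, norm_mul, e, Complex.norm_exp_ofReal_mul_I, mul_one]
  calc ‖1 + (a : ℂ) * π * I * w‖ ≤ ‖(1 : ℂ)‖ + ‖(a : ℂ) * π * I * w‖ := norm_add_le _ _
    _ = 1 + |(a : ℝ)| * π * |w| := by
        rw [norm_one, norm_mul, norm_mul, norm_mul, Complex.norm_I, mul_one, Complex.norm_real,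
          Real.norm_eq_abs, Complex.norm_real, Real.norm_eq_abs, abs_of_pos Real.pi_pos]
        norm_cast

omit [NeZero D] in
/-- `‖𝔣𝔣_{jμ}(w)‖ ≤ 6` for `|w| ≤ 1` (`𝔣𝔣_{jμ} = 𝔣𝔣_{a,k}` with `|a| ≤ 3/2`: `1 + 3π/2 < 6`).
[cite: Zhang2022LandauSiegel, §8 (8.13)–(8.18) p.48] -/
theorem norm_ffj_le {j μ : ℕ} (hj : j ∈ ({1, 2, 3} : Finset ℕ)) (hμ : μ ∈ ({6, 7} : Finset ℕ))
    {w : ℝ} (hw : |w| ≤ 1) : ‖ffj j μ w‖ ≤ 6 := by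
  have hπ := Real.pi_lt_d2
  have hπ0 := Real.pi_pos
  have key : ∀ a k : ℚ, |(a : ℝ)| ≤ 3 / 2 → ‖ffF a k w‖ ≤ 6 := by
    intro a k ha
    refine (norm_ffF_le' a k w).trans ?_
    have h1 : |(a : ℝ)| * |w| ≤ 3 / 2 * 1 := mul_le_mul ha hw (abs_nonneg _) (by norm_num)
    have h2 : |(a : ℝ)| * π * |w| = π * (|(a : ℝ)| * |w|) := by ring
    rw [h2]
    nlinarith [mul_nonneg (abs_nonneg (a : ℝ)) (abs_nonneg w)]
  simp only [Finset.mem_insert, Finset.mem_singleton] at hj hμ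
  rcases hj with rfl | rfl | rfl <;> rcases hμ with rfl | rfl
  · exact key (1/2) (3/2) (by norm_num)
  · exact key (3/2) (5/2) (by norm_num)
  · exact key (-1/2) (3/2) (by norm_num)
  · exact key (1/2) (5/2) (by norm_num)
  · exact key (-3/2) (3/2) (by norm_num)
  · exact key (-1/2) (5/2) (by norm_num)

/-- Norms of the numerical literals `0.504, 0.498, 0.5 : ℂ`. [folklore] -/
private theorem norm_lits3 : ‖(0.504 : ℂ)‖ = 0.504 ∧ ‖(0.498 : ℂ)‖ = 0.498 ∧ ‖(0.5 : ℂ)‖ = 0.5 := by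
  refine ⟨?_, ?_, ?_⟩
  · rw [show (0.504 : ℂ) = ((0.504 : ℝ) : ℂ) by norm_num, Complex.norm_real]; norm_num
  · rw [show (0.498 : ℂ) = ((0.498 : ℝ) : ℂ) by norm_num, Complex.norm_real]; norm_num
  · rw [show (0.5 : ℂ) = ((0.5 : ℝ) : ℂ) by norm_num, Complex.norm_real]; norm_num

omit [NeZero D] in
/-- A window integral against a bounded weight: `‖∫_{0.496}^{b} f(c − z)·W(z)dz‖ ≤ C_f·C_W·(b − 0.496)` when
`‖f‖ ≤ C_f` on `|w| ≤ 1` and `‖W(z)‖ ≤ C_W` on `[0.496, 0.5]` (`b ≤ 0.5`, `0 ≤ c − z ≤ 1` there). [folklore] -/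
private theorem norm_window_le {b c Cf CW : ℝ} (hb : 0.496 ≤ b) (hb' : b ≤ 0.5) (hc : b ≤ c) (hc' : c ≤ 1.496)
    {f W : ℝ → ℂ} (hf : ∀ w : ℝ, |w| ≤ 1 → ‖f w‖ ≤ Cf)
    (hW : ∀ z : ℝ, 0.496 ≤ z → z ≤ 0.5 → ‖W z‖ ≤ CW) :
    ‖∫ z in (0.496 : ℝ)..b, f (c - z) * W z‖ ≤ Cf * CW * (b - 0.496) := by
  have h := intervalIntegral.norm_integral_le_of_norm_le_const (a := (0.496 : ℝ)) (b := b)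
    (C := Cf * CW) (f := fun z => f (c - z) * W z) (fun x hx => by
      rw [Set.uIoc_of_le hb] at hx
      obtain ⟨hx1, hx2⟩ := hx
      rw [norm_mul]
      exact mul_le_mul (hf _ (by rw [abs_le]; constructor <;> linarith))
        (hW x (by linarith) (by linarith)) (norm_nonneg _)
        ((norm_nonneg _).trans (hf _ (by rw [abs_le]; constructor <;> linarith))))
  rw [abs_of_nonneg (by linarith)] at h
  exact h

/-- **The exact main term of (12.13) is `O(α𝔞)` uniformly in `D`:**
`‖main1213intEx‖ ≤ 𝔞α·6W(c′)(‖ι₃‖·0.002/(0.504·0.498) + ‖ι₄‖·0.004/(0.504·0.5))/π` (`j = 1,2,3`, `log D ≥ 1`).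
[cite: Zhang2022LandauSiegel, §12 (12.13) p.71] -/
theorem norm_main1213intEx_le (hD : 1 ≤ Real.log D) {j : ℕ} (hj : j ∈ ({1, 2, 3} : Finset ℕ)) :
    ‖main1213intEx c' χ j‖ ≤ frakA χ * alpha D *
      (6 * (1 + 18 * (1 + 5 * |c'| * π) ^ 2 * (521 * π) ^ 2 + (3 / 2 + 6 * (1 + 5 * |c'| * π)) * (521 * π)) *
        (‖iota3‖ * 0.002 / (0.504 * 0.498) + ‖iota4‖ * 0.004 / (0.504 * 0.5)) / π) := by
  obtain ⟨n504, n498, n5⟩ := norm_lits3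
  have hA := frakA_nonneg χ
  have hπ := Real.pi_pos
  have hα := alpha_pos_of_log (D := D) hD
  have hlogpos : 0 < Real.log (bigP D) := by rw [logP_eq_pi_div_alpha hD]; positivity
  set W := 1 + 18 * (1 + 5 * |c'| * π) ^ 2 * (521 * π) ^ 2 + (3 / 2 + 6 * (1 + 5 * |c'| * π)) * (521 * π)
    with hWdef
  have hW : 0 ≤ W := by positivity
  have hWz : ∀ z : ℝ, 0.496 ≤ z → z ≤ 0.5 → ‖frakwEx c' D j (bigP D ^ z)‖ ≤ W :=
    fun z hz1 hz2 => norm_frakwEx_rpow_le c' hD j hz1 hz2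
  set I6 := ∫ z in (0.496:ℝ)..0.498, ffj j 6 (0.498 - z) * frakwEx c' D j (bigP D ^ z)
  set I7 := ∫ z in (0.496:ℝ)..0.5, ffj j 7 (0.5 - z) * frakwEx c' D j (bigP D ^ z)
  have h6 : ‖I6‖ ≤ 6 * W * (0.498 - 0.496) :=
    norm_window_le (by norm_num) (by norm_num) (by norm_num) (by norm_num)
      (fun w hw => norm_ffj_le hj (by simp) hw) hWz
  have h7 : ‖I7‖ ≤ 6 * W * (0.5 - 0.496) :=
    norm_window_le (by norm_num) (by norm_num) (by norm_num) (by norm_num)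
      (fun w hw => norm_ffj_le hj (by simp) hw) hWz
  have e1 : ‖(frakA χ : ℂ) * conj iota3 / (0.504 * 0.498 * (Real.log (bigP D) : ℂ)) * I6‖ =
      frakA χ * ‖iota3‖ / (0.504 * 0.498 * Real.log (bigP D)) * ‖I6‖ := by
    rw [norm_mul, norm_div, norm_mul, norm_mul, norm_mul, Complex.norm_real, Complex.norm_real,
      Complex.norm_conj, Real.norm_of_nonneg hA, Real.norm_of_nonneg hlogpos.le, n504, n498]
  have e2 : ‖(frakA χ : ℂ) * conj iota4 / (0.504 * 0.5 * (Real.log (bigP D) : ℂ)) * I7‖ =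
      frakA χ * ‖iota4‖ / (0.504 * 0.5 * Real.log (bigP D)) * ‖I7‖ := by
    rw [norm_mul, norm_div, norm_mul, norm_mul, norm_mul, Complex.norm_real, Complex.norm_real,
      Complex.norm_conj, Real.norm_of_nonneg hA, Real.norm_of_nonneg hlogpos.le, n504, n5]
  rw [main1213intEx]
  calc ‖(frakA χ : ℂ) * conj iota3 / (0.504 * 0.498 * (Real.log (bigP D) : ℂ)) * I6 +
        (frakA χ : ℂ) * conj iota4 / (0.504 * 0.5 * (Real.log (bigP D) : ℂ)) * I7‖
      ≤ ‖(frakA χ : ℂ) * conj iota3 / (0.504 * 0.498 * (Real.log (bigP D) : ℂ)) * I6‖ +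
        ‖(frakA χ : ℂ) * conj iota4 / (0.504 * 0.5 * (Real.log (bigP D) : ℂ)) * I7‖ := norm_add_le _ _
    _ = frakA χ * ‖iota3‖ / (0.504 * 0.498 * Real.log (bigP D)) * ‖I6‖ +
        frakA χ * ‖iota4‖ / (0.504 * 0.5 * Real.log (bigP D)) * ‖I7‖ := by rw [e1, e2]
    _ ≤ frakA χ * ‖iota3‖ / (0.504 * 0.498 * Real.log (bigP D)) * (6 * W * (0.498 - 0.496)) +
        frakA χ * ‖iota4‖ / (0.504 * 0.5 * Real.log (bigP D)) * (6 * W * (0.5 - 0.496)) := by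
        gcongr
    _ = frakA χ * alpha D *
        (6 * W * (‖iota3‖ * 0.002 / (0.504 * 0.498) + ‖iota4‖ * 0.004 / (0.504 * 0.5)) / π) := by
        rw [logP_eq_pi_div_alpha hD]
        field_simp
        ring

/-- **The exact main term of §12.u049 is `O(α𝔞)` uniformly in `D`:**
`‖main12u049intEx‖ ≤ 𝔞α·7W*(c′)(‖ι₃‖·0.002/(0.504·0.498) + ‖ι₄‖·0.004/(0.504·0.5))/π` (`j = 1,2,3`, `log D ≥ 1`),
`W*(c′) = 1 + (9/2 + 15|c′|π)·521π`. [cite: Zhang2022LandauSiegel, §12 (12.16) p.73] -/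
theorem norm_main12u049intEx_le (hD : 1 ≤ Real.log D) {j : ℕ} (hj : j ∈ ({1, 2, 3} : Finset ℕ)) :
    ‖main12u049intEx c' χ j‖ ≤ frakA χ * alpha D *
      (7 * (1 + (9 / 2 + 15 * |c'| * π) * (521 * π)) *
        (‖iota3‖ * 0.002 / (0.504 * 0.498) + ‖iota4‖ * 0.004 / (0.504 * 0.5)) / π) := by
  obtain ⟨n504, n498, n5⟩ := norm_lits3
  have hA := frakA_nonneg χ
  have hπ := Real.pi_pos
  have hα := alpha_pos_of_log (D := D) hD
  have hlogpos : 0 < Real.log (bigP D) := by rw [logP_eq_pi_div_alpha hD]; positivity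
  set W := 1 + (9 / 2 + 15 * |c'| * π) * (521 * π) with hWdef
  have hW : 0 ≤ W := by positivity
  have hWz : ∀ z : ℝ, 0.496 ≤ z → z ≤ 0.5 → ‖frakwStarEx c' D j (bigP D ^ z)‖ ≤ W :=
    fun z hz1 hz2 => norm_frakwStarEx_rpow_le c' hD j hz1 hz2
  set I6 := ∫ z in (0.496:ℝ)..0.498, ghj j 6 (0.498 - z) * frakwStarEx c' D j (bigP D ^ z)
  set I7 := ∫ z in (0.496:ℝ)..0.5, ghj j 7 (0.5 - z) * frakwStarEx c' D j (bigP D ^ z)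
  have h6 : ‖I6‖ ≤ 7 * W * (0.498 - 0.496) :=
    norm_window_le (by norm_num) (by norm_num) (by norm_num) (by norm_num)
      (fun w hw => norm_ghj_le hj (by simp) hw) hWz
  have h7 : ‖I7‖ ≤ 7 * W * (0.5 - 0.496) :=
    norm_window_le (by norm_num) (by norm_num) (by norm_num) (by norm_num)
      (fun w hw => norm_ghj_le hj (by simp) hw) hWz
  have e1 : ‖(frakA χ : ℂ) * iota3 / (0.504 * 0.498 * (Real.log (bigP D) : ℂ)) * I6‖ =
      frakA χ * ‖iota3‖ / (0.504 * 0.498 * Real.log (bigP D)) * ‖I6‖ := by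
    rw [norm_mul, norm_div, norm_mul, norm_mul, norm_mul, Complex.norm_real, Complex.norm_real,
      Real.norm_of_nonneg hA, Real.norm_of_nonneg hlogpos.le, n504, n498]
  have e2 : ‖(frakA χ : ℂ) * iota4 / (0.504 * 0.5 * (Real.log (bigP D) : ℂ)) * I7‖ =
      frakA χ * ‖iota4‖ / (0.504 * 0.5 * Real.log (bigP D)) * ‖I7‖ := by
    rw [norm_mul, norm_div, norm_mul, norm_mul, norm_mul, Complex.norm_real, Complex.norm_real,
      Real.norm_of_nonneg hA, Real.norm_of_nonneg hlogpos.le, n504, n5]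
  rw [main12u049intEx]
  calc ‖(frakA χ : ℂ) * iota3 / (0.504 * 0.498 * (Real.log (bigP D) : ℂ)) * I6 +
        (frakA χ : ℂ) * iota4 / (0.504 * 0.5 * (Real.log (bigP D) : ℂ)) * I7‖
      ≤ ‖(frakA χ : ℂ) * iota3 / (0.504 * 0.498 * (Real.log (bigP D) : ℂ)) * I6‖ +
        ‖(frakA χ : ℂ) * iota4 / (0.504 * 0.5 * (Real.log (bigP D) : ℂ)) * I7‖ := norm_add_le _ _
    _ = frakA χ * ‖iota3‖ / (0.504 * 0.498 * Real.log (bigP D)) * ‖I6‖ +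
        frakA χ * ‖iota4‖ / (0.504 * 0.5 * Real.log (bigP D)) * ‖I7‖ := by rw [e1, e2]
    _ ≤ frakA χ * ‖iota3‖ / (0.504 * 0.498 * Real.log (bigP D)) * (7 * W * (0.498 - 0.496)) +
        frakA χ * ‖iota4‖ / (0.504 * 0.5 * Real.log (bigP D)) * (7 * W * (0.5 - 0.496)) := by
        gcongr
    _ = frakA χ * alpha D *
        (7 * W * (‖iota3‖ * 0.002 / (0.504 * 0.498) + ‖iota4‖ * 0.004 / (0.504 * 0.5)) / π) := by
        rw [logP_eq_pi_div_alpha hD]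
        field_simp
        ring

/-- The size hypothesis of the generic assembler for `M₂₅ = main1213intEx`: `‖main1213intEx c′ χ j‖ ≤ Kα(𝔞+1)`
for all large `D`, `j = 1,2,3`. [cite: Zhang2022LandauSiegel, §12 (12.13) p.71] -/
theorem size_main1213intEx : ∃ K : ℝ, ForAllLarge fun D _ χ => AssumptionA D χ →
    ∀ j ∈ ({1, 2, 3} : Finset ℕ), ‖main1213intEx c' χ j‖ ≤ K * alpha D * (frakA χ + 1) := by
  set K := 6 * (1 + 18 * (1 + 5 * |c'| * π) ^ 2 * (521 * π) ^ 2 +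
      (3 / 2 + 6 * (1 + 5 * |c'| * π)) * (521 * π)) *
    (‖iota3‖ * 0.002 / (0.504 * 0.498) + ‖iota4‖ * 0.004 / (0.504 * 0.5)) / π with hK
  have hπ := Real.pi_pos
  have hK0 : 0 ≤ K := by positivity
  obtain ⟨D₀, h⟩ := forAllLarge_log_ge 1
  refine ⟨K, D₀, fun D _ χ hD hq hp _ j hj => ?_⟩
  have hD1 : 1 ≤ Real.log D := h D χ hD hq hp
  have hα := (alpha_pos_of_log (D := D) hD1).le
  have hb := norm_main1213intEx_le c' χ hD1 hj
  calc ‖main1213intEx c' χ j‖ ≤ frakA χ * alpha D * K := hb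
    _ ≤ K * alpha D * (frakA χ + 1) := by nlinarith [mul_nonneg hK0 hα, frakA_nonneg χ]

/-- The size hypothesis of the generic assembler for `M₂₂ = main12u049intEx`. [cite: Zhang2022LandauSiegel, §12 (12.16) p.73] -/
theorem size_main12u049intEx : ∃ K : ℝ, ForAllLarge fun D _ χ => AssumptionA D χ →
    ∀ j ∈ ({1, 2, 3} : Finset ℕ), ‖main12u049intEx c' χ j‖ ≤ K * alpha D * (frakA χ + 1) := by
  set K := 7 * (1 + (9 / 2 + 15 * |c'| * π) * (521 * π)) *
    (‖iota3‖ * 0.002 / (0.504 * 0.498) + ‖iota4‖ * 0.004 / (0.504 * 0.5)) / π with hK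
  have hπ := Real.pi_pos
  have hK0 : 0 ≤ K := by positivity
  obtain ⟨D₀, h⟩ := forAllLarge_log_ge 1
  refine ⟨K, D₀, fun D _ χ hD hq hp _ j hj => ?_⟩
  have hD1 : 1 ≤ Real.log D := h D χ hD hq hp
  have hα := (alpha_pos_of_log (D := D) hD1).le
  have hb := norm_main12u049intEx_le c' χ hD1 hj
  calc ‖main12u049intEx c' χ j‖ ≤ frakA χ * alpha D * K := hb
    _ ≤ K * alpha D * (frakA χ + 1) := by nlinarith [mul_nonneg hK0 hα, frakA_nonneg χ]

end MainTerms

/-! ## The assemblers of record -/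

section Assemblers

variable (c' : ℝ)

/-- The window-value node in the shape the generic assembler consumes (absolute currency): `Win1217Ex`
(`≤ 5·10⁻⁶𝔞`, no (A)) gives `≤ 5·10⁻⁶𝔞 + ε` under (A), every `ε > 0`. [cite: Zhang2022LandauSiegel, §12 (12.17) p.73] -/
theorem win1217Ex_eps (hWin : Win1217Ex c') :
    ∀ ε : ℝ, 0 < ε → ForAllLarge fun D _ χ => AssumptionA D χ →
      ‖(1 / (2 * alpha D) * main1213intEx c' χ 1 + 2 / alpha D * main1213intEx c' χ 2 +
            3 / (2 * alpha D) * main1213intEx c' χ 3 +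
          conj (1 / (2 * alpha D) * main12u049intEx c' χ 1 + 2 / alpha D * main12u049intEx c' χ 2 +
            3 / (2 * alpha D) * main12u049intEx c' χ 3) : ℂ) -
        2 * frakA χ * e2star‖ ≤ 5e-6 * frakA χ + ε := fun ε hε =>
  hWin.mono fun D _ χ _ _ h _ => h.trans (by linarith)

/-- The window-value node in the relative shape: `≤ 5·10⁻⁶𝔞 + ε(𝔞+1)`. [cite: Zhang2022LandauSiegel, §12 (12.17) p.73] -/
theorem win1217Ex_eps_rel (hWin : Win1217Ex c') :
    ∀ ε : ℝ, 0 < ε → ForAllLarge fun D _ χ => AssumptionA D χ →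
      ‖(1 / (2 * alpha D) * main1213intEx c' χ 1 + 2 / alpha D * main1213intEx c' χ 2 +
            3 / (2 * alpha D) * main1213intEx c' χ 3 +
          conj (1 / (2 * alpha D) * main12u049intEx c' χ 1 + 2 / alpha D * main12u049intEx c' χ 2 +
            3 / (2 * alpha D) * main12u049intEx c' χ 3) : ℂ) -
        2 * frakA χ * e2star‖ ≤ 5e-6 * frakA χ + ε * (frakA χ + 1) := fun ε hε =>
  hWin.mono fun D _ χ _ _ h _ => h.trans (by nlinarith [frakA_nonneg χ])

/-- **(12.17) from the exact-reading nodes — the assembler of record `eval1217_of_exact` (R-18):**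
`Prop71 → Eq129 → Eq1212 → Mid1225 → Top1225Ex → Low1522 → Top1522Ex → Win1217Ex → Skeleton.Eval1217 c′`.
"Finally, by (12.9), (12.15) and (12.16) we conclude (12.17)" (p. 73, tex L3713): Proposition 7.1 at
`(𝐚₁₂,𝐚₂₅)`, `(𝐚₁₅,𝐚₂₂)` (admissible), the weighted `S_j`-sums from the range nodes (`e₁*` by the exact `β`-algebra
of (2.13)), the window value `5·10⁻⁶𝔞 < 10⁻⁵𝔞`, and the tacit `E(·,·) = o(𝔓)` from the range nodes and the
uniform `O(α𝔞)` size of the exact main terms. Every node is a HYPOTHESIS; nothing about the truth of the nodes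
is asserted. [cite: Zhang2022LandauSiegel, §12 (12.17) p.73] -/
theorem eval1217_of_exact (h71 : Prop71 c') (h129 : Eq129 c') (h1212 : Eq1212 c') (hMid : Mid1225 c')
    (hTop25 : Top1225Ex c') (hLow : Low1522 c') (hTop22 : Top1522Ex c') (hWin : Win1217Ex c') :
    Eval1217 c' :=
  eval1217_of_top_ranges' c' (fun D _ χ j => main1213intEx c' χ j) (fun D _ χ j => main12u049intEx c' χ j)
    (κ := 5e-6) (by norm_num) h71 h129 h1212 hMid hTop25 hLow hTop22 (size_main1213intEx c')
    (size_main12u049intEx c') (win1217Ex_eps c' hWin)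

/-- **The typed deduction node `DedEval1217Ex c′` HOLDS** (R-18 assembler, argument order as the skeleton pen
threads it). [cite: Zhang2022LandauSiegel, §12 (12.17) p.73] -/
theorem dedEval1217Ex_holds : DedEval1217Ex c' := eval1217_of_exact c'

/-- `DedEval1217Ex` — `_holds` alias of `dedEval1217Ex_holds` above under the fact's exact name (appended
2026-08-28, D-0026 bookkeeping: the proof term is the existing theorem of this file; no statement,
definition or attribute is edited; no new named fact; the ledger's debt table listed the fact
unproved). [cite: Zhang2022LandauSiegel, §12 (12.17) p.73] -/
theorem _root_.Literature.NumberTheory.LFunctions.Zhang2022.Typed.Sec12C.DedEval1217Ex_holds :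
    DedEval1217Ex c' :=
  _root_.Literature.NumberTheory.LFunctions.Zhang2022.Sec12D.dedEval1217Ex_holds (c' := c')

/-- **(12.17) from the v19 leaf `hXi` and the exact-reading nodes** — the skeleton plug: (12.9) is supplied from
`Xi15Hbar16` by Lemma 8.1 (`Sec12D.ded129_holds`). [cite: Zhang2022LandauSiegel, §12 (12.9), (12.17) pp.68–73] -/
theorem eval1217_of_exact_leaves (h71 : Prop71 c') (h81 : Lemma81 c') (hXi : Xi15Hbar16 c')
    (h1212 : Eq1212 c') (hMid : Mid1225 c') (hTop25 : Top1225Ex c') (hLow : Low1522 c')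
    (hTop22 : Top1522Ex c') (hWin : Win1217Ex c') : Eval1217 c' :=
  eval1217_of_exact c' h71 (ded129_holds c' hXi h81) h1212 hMid hTop25 hLow hTop22 hWin

/-- **(12.17)ᴿ from the exact-reading nodes in the RELATIVE currency — the assembler of record
`eval1217Rel_of_exact` (R-25 / RT-06):** `Prop22i → Lemma23 → Prop71 → Lemma81 → Eval97With c′ k → Eq126 → Eq128 →
Eq1212 → Mid1225 → Top1225Ex → Low1522 → Top1522Ex → Win1217Ex → Skeleton.Eval1217Rel c′`. Front end: the display
of p. 68 by Cauchy in the relative reading and (12.9)ᴿ by Lemma 8.1 (`Sec12D.xi15Hbar16_rel_of_eq126_eq128`,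
`eq129_rel_of_xi15_rel`); back end: the generic assembler with weight `𝔞 + 1`.
[cite: Zhang2022LandauSiegel, §12 (12.6)–(12.17) pp.66–73] -/
theorem eval1217Rel_of_exact (h22 : Prop22i) (h23 : Lemma23 c') (h71 : Prop71 c') (h81 : Lemma81 c')
    {k : ℝ} (h97 : Eval97With c' k) (h126 : Eq126 c') (h128 : Eq128 c') (h1212 : Eq1212 c')
    (hMid : Mid1225 c') (hTop25 : Top1225Ex c') (hLow : Low1522 c') (hTop22 : Top1522Ex c')
    (hWin : Win1217Ex c') : Eval1217Rel c' :=
  eval1217Rel_of_top_ranges' c' (fun D _ χ j => main1213intEx c' χ j) (fun D _ χ j => main12u049intEx c' χ j)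
    (κ := 5e-6) (by norm_num) h71
    (eq129_rel_of_xi15_rel c' h81 (xi15Hbar16_rel_of_eq126_eq128 c' h22 h23 h97 h126 h128))
    h1212 hMid hTop25 hLow hTop22 (size_main1213intEx c') (size_main12u049intEx c')
    (win1217Ex_eps_rel c' hWin)

/-- **(12.17)ᴿ from `hXi` read relatively and the exact-reading nodes** (for a re-thread keeping one §12
display hypothesis in place of `hXi`). [cite: Zhang2022LandauSiegel, §12 (12.9)–(12.17) pp.68–73] -/
theorem eval1217Rel_of_exact_xi (h71 : Prop71 c') (h81 : Lemma81 c')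
    (hXi : ∀ ε : ℝ, 0 < ε → ForAllLarge fun D _ χ => AssumptionA D χ →
      ‖xi15 c' χ - xi15viaHbar16 c' χ‖ ≤ ε * (frakA χ + 1) * frakP D)
    (h1212 : Eq1212 c') (hMid : Mid1225 c') (hTop25 : Top1225Ex c') (hLow : Low1522 c')
    (hTop22 : Top1522Ex c') (hWin : Win1217Ex c') : Eval1217Rel c' :=
  eval1217Rel_of_top_ranges' c' (fun D _ χ j => main1213intEx c' χ j) (fun D _ χ j => main12u049intEx c' χ j)
    (κ := 5e-6) (by norm_num) h71 (eq129_rel_of_xi15_rel c' h81 hXi)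
    h1212 hMid hTop25 hLow hTop22 (size_main1213intEx c') (size_main12u049intEx c')
    (win1217Ex_eps_rel c' hWin)

/-- **The typed deduction node `DedEval1217RelEx c′ k` HOLDS** (the assembler of record in the RELATIVE currency,
R-25/R-29 = RT-06; argument order as the skeleton pen threads it). [cite: Zhang2022LandauSiegel, §12 (12.17) p.73] -/
theorem dedEval1217RelEx_holds (k : ℝ) : DedEval1217RelEx c' k :=
  fun h22 h23 h71 h81 h97 => eval1217Rel_of_exact c' h22 h23 h71 h81 h97

end Assemblers

end Literature.NumberTheory.LFunctions.Zhang2022.Sec12D
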